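import Summits.AtomisticToContinuum.Crystallization.Theorems.PerronTransitivityUniformBindingRigidityCohesionH
import Summits.AtomisticToContinuum.Crystallization.Theorems.ThreeConeCertificateOnePercentCertificateFccWindow

/-!
# Cohesion of uniformly bound Lennard-Jones configurations, VIII': the core at the level `−1.435`

Computational companion (`--supports stmt-AtomisticToContinuum-15099`, `--computational`) of part
VIII (`…CohesionH.lean`) for the stub `stub_noThickHalfSpaceBinding` of the line `registered` of the
crux `Summit.AtomisticToContinuum.Crystallization.Theses.PerronTransitivity.UniformBindingRigidity`
(item stmt-AtomisticToContinuum-15099):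

* `two_mul_iInf_le_sharp` — `2e* ≤ −1435/1000`, twice the tree's certified window
  `OnePercentFccWindow.eStar_le : e* ≤ −0.7175` (fcc at nearest-neighbour distance `√0.943`, exact
  rational lattice sum over the box `[−48, 48]³` evaluated by `native_decide`; so every declaration
  here carries the axiom `Lean.ofReduceBool` of that certificate on top of the whitelist — this is
  why the level `1435/1000` lives in its own file; the believed value is `2e* = 2e(hcp) ≈ −1.4352`);
* `noThickHalfSpaceBinding_of_core` / registered sub-goal `stub_noThickHalfSpaceBinding_of_core` —
  the stub follows verbatim from `(CORE)` at the level `1435/1000` (part VIII's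
  `noThickHalfSpaceBinding_of_core_at`).

All `[folklore]`.
-/

noncomputable section

namespace Summit.AtomisticToContinuum.Crystallization.Theorems.PerronTransitivityUniformBindingRigidity

open scoped BigOperators
open Literature.MathematicalPhysics.StatisticalMechanics
open Summit.AtomisticToContinuum.Crystallization.Theorems.ChargedEnergyGapNegative (E3 eStar)

/-- `2 e* ≤ −1435/1000`: twice the tree's certified window `e* ≤ −0.7175`
(`OnePercentFccWindow.eStar_le`, computational). [folklore] -/
theorem two_mul_iInf_le_sharp :
    2 * (⨅ Q : PeriodicConfiguration 3, Q.energyPerParticle lennardJones) ≤ -(1435 / 1000) := by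
  have h : eStar ≤ -(7175 / 10000) := OnePercentFccWindow.eStar_le
  unfold eStar at h
  linarith

/-- A uniformly `2e*`-bound set is uniformly `(−1435/1000)`-bound. [folklore] -/
theorem siteSum_le_sharp_of_le_two_mul_iInf {Y : Set E3} {p : E3}
    (h : ∑' q : {q : E3 // q ∈ Y ∧ q ≠ p}, lennardJones (dist p q.1) ≤
      2 * (⨅ Q : PeriodicConfiguration 3, Q.energyPerParticle lennardJones)) :
    ∑' q : {q : E3 // q ∈ Y ∧ q ≠ p}, lennardJones (dist p q.1) ≤ -(1435 / 1000) :=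
  h.trans two_mul_iInf_le_sharp

/-- **`(NHB-thick)` from `(CORE)` at the level `−1.435`.** If no `1/4`-separated thick half-space
configuration through `0` has all its Lennard-Jones site sums `≤ −1435/1000`, then every such
configuration has a site with site sum `> 2e*` (`noThickHalfSpaceBinding_of_core_at` with
`two_mul_iInf_le_sharp`). [folklore] -/
theorem noThickHalfSpaceBinding_of_core
    (CORE : ∀ (Y : Set (EuclideanSpace ℝ (Fin 3))) (u : EuclideanSpace ℝ (Fin 3)), ‖u‖ = 1 →
      (0 : EuclideanSpace ℝ (Fin 3)) ∈ Y →
      (∀ p ∈ Y, ∀ q ∈ Y, p ≠ q → 1 / 4 ≤ dist p q) →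
      (∀ q ∈ Y, inner ℝ q u ≤ 0) →
      (∀ t : ℝ, ∃ q ∈ Y, inner ℝ q u < -t) →
      (∀ p ∈ Y, ∑' q : {q : EuclideanSpace ℝ (Fin 3) // q ∈ Y ∧ q ≠ p},
          lennardJones (dist p q.1) ≤ -(1435 / 1000)) →
      False) :
    ∀ (Y : Set (EuclideanSpace ℝ (Fin 3))) (u : EuclideanSpace ℝ (Fin 3)), ‖u‖ = 1 →
      (0 : EuclideanSpace ℝ (Fin 3)) ∈ Y →
      (∀ p ∈ Y, ∀ q ∈ Y, p ≠ q → 1 / 4 ≤ dist p q) →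
      (∀ q ∈ Y, inner ℝ q u ≤ 0) →
      (∀ t : ℝ, ∃ q ∈ Y, inner ℝ q u < -t) →
      ∃ p ∈ Y, 2 * (⨅ Q : PeriodicConfiguration 3, Q.energyPerParticle lennardJones) <
        ∑' q : {q : EuclideanSpace ℝ (Fin 3) // q ∈ Y ∧ q ≠ p}, lennardJones (dist p q.1) :=
  noThickHalfSpaceBinding_of_core_at two_mul_iInf_le_sharp CORE

/-! ## Registered sub-goal of `stub_noThickHalfSpaceBinding`: the core at the level `−1.435` -/

/-- **Sub-goal `stub_noThickHalfSpaceBinding_of_core` of the stub `stub_noThickHalfSpaceBinding`**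
(registered on stmt-AtomisticToContinuum-15099): `(CORE)` at the level `1435/1000` implies the stub
verbatim (`noThickHalfSpaceBinding_of_core` in arrow form; computational through
`two_mul_iInf_le_sharp`). [folklore] -/
theorem stub_noThickHalfSpaceBinding_of_core :
    (∀ (Y : Set (EuclideanSpace ℝ (Fin 3))) (u : EuclideanSpace ℝ (Fin 3)), ‖u‖ = 1 →
      (0 : EuclideanSpace ℝ (Fin 3)) ∈ Y →
      (∀ p ∈ Y, ∀ q ∈ Y, p ≠ q → 1 / 4 ≤ dist p q) →
      (∀ q ∈ Y, inner ℝ q u ≤ 0) →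
      (∀ t : ℝ, ∃ q ∈ Y, inner ℝ q u < -t) →
      (∀ p ∈ Y, ∑' q : {q : EuclideanSpace ℝ (Fin 3) // q ∈ Y ∧ q ≠ p},
          lennardJones (dist p q.1) ≤ -(1435 / 1000)) →
      False) →
    ∀ (Y : Set (EuclideanSpace ℝ (Fin 3))) (u : EuclideanSpace ℝ (Fin 3)), ‖u‖ = 1 →
      (0 : EuclideanSpace ℝ (Fin 3)) ∈ Y →
      (∀ p ∈ Y, ∀ q ∈ Y, p ≠ q → 1 / 4 ≤ dist p q) →
      (∀ q ∈ Y, inner ℝ q u ≤ 0) →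
      (∀ t : ℝ, ∃ q ∈ Y, inner ℝ q u < -t) →
      ∃ p ∈ Y, 2 * (⨅ Q : PeriodicConfiguration 3, Q.energyPerParticle lennardJones) <
        ∑' q : {q : EuclideanSpace ℝ (Fin 3) // q ∈ Y ∧ q ≠ p}, lennardJones (dist p q.1) :=
  fun CORE => noThickHalfSpaceBinding_of_core CORE

end Summit.AtomisticToContinuum.Crystallization.Theorems.PerronTransitivityUniformBindingRigidity

end
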